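import Mathlib

/-!
# Helpers for `HomogeneousEntireRigidity` (route MarkovRigidity of `Ising3DConformalLimit`,
item stmt-CriticalPhenomena-6231) — complex-analytic, linear-algebraic and measure-theoretic
lemmas

This file supports `Theorems/MarkovRigidityHomogeneousEntireRigidity.lean`, which proves the
route decl `HomogeneousEntireRigidity`: an entire `P : ℂ³ → ℂ`, real and `≥ 0` on `ℝ³`, not
identically zero there, positively homogeneous of degree `m ∈ (0,3)` on `ℝ³` and with `1/P`
locally integrable on `ℝ³`, has `m = 2` and `P|ℝ³` a positive-definite quadratic form.

Contents (all elementary and self-contained; pure Mathlib, no named facts):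
* `entire_eq_of_eqOn_pos` — identity principle from the positive half-line;
* `exists_nat_eq_of_entire_eq_rpow` — an entire `g` with `g t = t ^ m c` (`c ≠ 0`) for `t > 0`
  has `m ∈ ℕ`: the scaling identity `g (2t) = 2 ^ m g t` holds on `ℂ`, and comparing Taylor
  coefficients at `0` gives `(2 ^ n − 2 ^ m) g⁽ⁿ⁾(0) = 0` for every `n` (else `g ≡ 0`);
* `iteratedDeriv_two_comp_smul`, `iteratedDeriv_two_sq_mul`, `bilin_expand` — the second
  derivative along a line is `D²P(0)(v,v)`, `(t² c)'' = 2c`, and the expansion of a bilinear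
  form in the basis `Pi.single i 1`;
* `dotProduct_mulVec_comm`, `mulVec_eq_zero_of_psd`, `quad_add_smul_ker` — for a symmetric
  positive semidefinite real matrix an isotropic vector lies in the kernel, and the quadratic
  form is invariant under translation by kernel vectors;
* `det_dilation`, `eq_zero_of_locallyIntegrable_inv` — **degenerate directions destroy local
  integrability**: a continuous `2`-homogeneous `q : ℝ³ → ℝ`, invariant under translation by a
  non-zero `x₀` and with `1/q` locally Lebesgue integrable, vanishes identically. The weighted
  measure `(1/q) dy` is invariant under the anisotropic dilations
  `A_c y = c y − ((c−1) y i₀ / x₀ i₀) x₀` (`det A_c = c²`, `q ∘ A_c = c² q`), so the cylinders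
  `{|y i₀| < 1, ‖y − (y i₀/x₀ i₀) x₀‖ < r}` all carry the same finite weight, which by continuity
  from above equals the weight of the axis `ℝ x₀`, i.e. `0`; so `q = 0` a.e. near `0`, hence
  everywhere by continuity and homogeneity.

No definitions are introduced.
-/

namespace Summit.CriticalPhenomena.Ising3DConformalLimit.Theorems.HomogeneousEntireRigidity

open Complex Filter Topology MeasureTheory Set
open scoped ENNReal Matrix


/-- Identity principle from the positive half-line: two entire functions on `ℂ` that agree at
every positive real agree everywhere. -/
theorem entire_eq_of_eqOn_pos {f g : ℂ → ℂ} (hf : ∀ z, AnalyticAt ℂ f z)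
    (hg : ∀ z, AnalyticAt ℂ g z) (h : ∀ t : ℝ, 0 < t → f t = g t) : f = g := by
  have ht : Tendsto (fun t : ℝ => (t : ℂ)) (𝓝[≠] (1 : ℝ)) (𝓝[≠] (1 : ℂ)) := by
    refine tendsto_nhdsWithin_of_tendsto_nhds_of_eventually_within _ ?_ ?_
    · have := (Complex.continuous_ofReal.tendsto (1 : ℝ)).mono_left
        (nhdsWithin_le_nhds (s := {(1:ℝ)}ᶜ))
      simpa using this
    · filter_upwards [self_mem_nhdsWithin] with t ht
      simpa using ht
  have hev : ∀ᶠ t : ℝ in 𝓝[≠] (1 : ℝ), f t = g t := by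
    have h1 : ∀ᶠ t : ℝ in 𝓝[≠] (1 : ℝ), 0 < t :=
      mem_nhdsWithin_of_mem_nhds (Ioi_mem_nhds one_pos)
    filter_upwards [h1] with t ht using h t ht
  exact AnalyticOnNhd.eq_of_frequently_eq (fun z _ => hf z) (fun z _ => hg z)
    (ht.frequently hev.frequently)

/-- An entire function which equals `t ↦ t ^ m · c` (`c ≠ 0`, real exponent `m`) on the positive
half-line has `m ∈ ℕ`: the scaling identity `g (2t) = 2 ^ m g t` extends to `ℂ`, and comparing
Taylor coefficients at `0` gives `(2 ^ n - 2 ^ m) g⁽ⁿ⁾(0) = 0` for every `n`. -/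
theorem exists_nat_eq_of_entire_eq_rpow {g : ℂ → ℂ} (hg : ∀ z, AnalyticAt ℂ g z) {m : ℝ}
    {c : ℂ} (hc : c ≠ 0) (h : ∀ t : ℝ, 0 < t → g t = ((t ^ m : ℝ) : ℂ) * c) :
    ∃ n : ℕ, (n : ℝ) = m := by
  have hscale : (fun z => g (2 * z)) = fun z => (((2 : ℝ) ^ m : ℝ) : ℂ) * g z := by
    refine entire_eq_of_eqOn_pos (fun z => ?_) (fun z => analyticAt_const.mul (hg z)) ?_
    · exact (hg _).fun_comp (analyticAt_const.mul analyticAt_id)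
    · intro t ht
      have h2 : ((2 : ℂ) * (t : ℂ)) = ((2 * t : ℝ) : ℂ) := by push_cast; ring
      simp only [h2, h _ (by positivity : (0:ℝ) < 2 * t), h t ht,
        Real.mul_rpow (by norm_num : (0:ℝ) ≤ 2) ht.le]
      push_cast; ring
  by_contra hne
  push Not at hne
  have hdiff : Differentiable ℂ g := fun z => (hg z).differentiableAt
  have hD : ∀ n : ℕ, iteratedDeriv n g 0 = 0 := by
    intro n
    have hcd : ContDiff ℂ n g := AnalyticOnNhd.contDiff (fun z _ => hg z)
    have e1 := congrArg (fun F : ℂ → ℂ => iteratedDeriv n F 0) hscale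
    simp only [iteratedDeriv_comp_const_mul hcd, iteratedDeriv_const_mul_field, mul_zero] at e1
    have hne' : ((2 : ℂ) ^ n) ≠ (((2 : ℝ) ^ m : ℝ) : ℂ) := by
      have h2 : ((2:ℝ) ^ (n : ℝ)) ≠ (2 : ℝ) ^ m := by
        intro h'
        rcases lt_or_gt_of_ne (hne n) with hlt | hgt
        · exact absurd h' (ne_of_lt ((Real.rpow_lt_rpow_left_iff (by norm_num)).2 hlt))
        · exact absurd h' (ne_of_gt ((Real.rpow_lt_rpow_left_iff (by norm_num)).2 hgt))
      rw [Real.rpow_natCast] at h2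
      exact_mod_cast h2
    have h3 := sub_eq_zero.mpr e1
    rw [← sub_mul, mul_eq_zero] at h3
    rcases h3 with h0 | h0
    · exact absurd (sub_eq_zero.mp h0) hne'
    · exact h0
  have hg1 : g 1 = 0 := by
    rw [← Complex.taylorSeries_eq_of_entire' (c := 0) (z := 1) hdiff]
    simp [hD]
  have h1 := h 1 one_pos
  simp only [Real.one_rpow, Complex.ofReal_one, one_mul, hg1] at h1
  exact hc h1.symm

/-- Second derivative at `0` along a line through the origin: for `P` of class `C²`,
`(d/dt)² P (t v) |_{t=0} = D²P(0)(v, v)`. -/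
theorem iteratedDeriv_two_comp_smul {E : Type*} [NormedAddCommGroup E] [NormedSpace ℂ E]
    {P : E → ℂ} (hP : ContDiff ℂ 2 P) (v : E) :
    iteratedDeriv 2 (fun t : ℂ => P (t • v)) 0 = fderiv ℂ (fderiv ℂ P) 0 v v := by
  have h1 : (fun t : ℂ => P (t • v)) = P ∘ (ContinuousLinearMap.toSpanSingleton ℂ v) := by
    funext t; simp [ContinuousLinearMap.toSpanSingleton_apply]
  rw [h1, iteratedDeriv_eq_iteratedFDeriv,
    ContinuousLinearMap.iteratedFDeriv_comp_right _ hP _ (by norm_cast),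
    ContinuousMultilinearMap.compContinuousLinearMap_apply]
  simp [iteratedFDeriv_two_apply, ContinuousLinearMap.toSpanSingleton_apply]

/-- `(d/dt)² (t² c) = 2c`. -/
theorem iteratedDeriv_two_sq_mul (c : ℂ) :
    iteratedDeriv 2 (fun t : ℂ => t ^ 2 * c) 0 = 2 * c := by
  rw [show (2:ℕ) = 0 + 1 + 1 from rfl, iteratedDeriv_succ, iteratedDeriv_succ, iteratedDeriv_zero]
  have hd : deriv (fun t : ℂ => t ^ 2 * c) = fun t => 2 * t * c := by
    funext t
    simp [mul_comm]
  rw [hd]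
  have hd2 : deriv (fun t : ℂ => 2 * t * c) = fun _ => 2 * c := by
    funext t
    have : (fun t : ℂ => 2 * t * c) = fun t => (2 * c) * t := by funext s; ring
    rw [this, deriv_const_mul_field (2 * c) (v := fun t : ℂ => t), deriv_id'']
    simp
  rw [hd2]

/-- Expansion of a continuous bilinear form on `Fin 3 → ℂ` on the diagonal in the standard
basis `Pi.single i 1`. -/
theorem bilin_expand (B : (Fin 3 → ℂ) →L[ℂ] (Fin 3 → ℂ) →L[ℂ] ℂ) (v : Fin 3 → ℂ) :
    B v v = ∑ i, ∑ j, v i * v j * B (Pi.single i 1) (Pi.single j 1) := by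
  have hv : v = ∑ i, v i • (Pi.single i (1:ℂ) : Fin 3 → ℂ) := pi_eq_sum_univ' v
  calc B v v = B (∑ i, v i • (Pi.single i (1:ℂ) : Fin 3 → ℂ)) v := by rw [← hv]
    _ = ∑ i, v i * B (Pi.single i 1) v := by
        rw [map_sum, FunLike.coe_sum, Finset.sum_apply]
        refine Finset.sum_congr rfl fun i _ => ?_
        rw [map_smul, FunLike.coe_smul, Pi.smul_apply, smul_eq_mul]
    _ = ∑ i, v i * B (Pi.single i 1) (∑ j, v j • (Pi.single j (1:ℂ) : Fin 3 → ℂ)) := by rw [← hv]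
    _ = ∑ i, ∑ j, v i * v j * B (Pi.single i 1) (Pi.single j 1) := by
        refine Finset.sum_congr rfl fun i _ => ?_
        rw [map_sum, Finset.mul_sum]
        refine Finset.sum_congr rfl fun j _ => ?_
        rw [map_smul, smul_eq_mul]
        ring


/-- A symmetric real matrix gives a symmetric bilinear pairing `u ⬝ᵥ Q *ᵥ v`. -/
theorem dotProduct_mulVec_comm {n : Type*} [Fintype n] {Q : Matrix n n ℝ} (hQ : Q.transpose = Q)
    (u v : n → ℝ) : u ⬝ᵥ (Q *ᵥ v) = v ⬝ᵥ (Q *ᵥ u) := by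
  rw [Matrix.dotProduct_mulVec, ← Matrix.mulVec_transpose, hQ, dotProduct_comm]

/-- For a symmetric positive semidefinite real matrix, an isotropic vector lies in the kernel
(minimise `t ↦ (x + t y)ᵀ Q (x + t y)`). -/
theorem mulVec_eq_zero_of_psd {n : Type*} [Fintype n] [DecidableEq n] {Q : Matrix n n ℝ}
    (hQ : Q.transpose = Q) (hpsd : ∀ y, 0 ≤ y ⬝ᵥ (Q *ᵥ y)) {x : n → ℝ} (hx : x ⬝ᵥ (Q *ᵥ x) = 0) :
    Q *ᵥ x = 0 := by
  have hb : ∀ y, x ⬝ᵥ (Q *ᵥ y) = 0 := by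
    intro y
    set b := x ⬝ᵥ (Q *ᵥ y) with hb_def
    set a := y ⬝ᵥ (Q *ᵥ y) with ha_def
    have ha : 0 ≤ a := hpsd y
    have hsym : y ⬝ᵥ (Q *ᵥ x) = b := dotProduct_mulVec_comm hQ y x
    have key : ∀ t : ℝ, 0 ≤ 2 * t * b + t ^ 2 * a := by
      intro t
      have h := hpsd (x + t • y)
      simp only [Matrix.mulVec_add, Matrix.mulVec_smul, dotProduct_add, add_dotProduct,
        dotProduct_smul, smul_dotProduct, smul_eq_mul, hx] at h
      rw [hsym] at h
      nlinarith [h]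
    by_contra hb0
    have h := key (-b / (a + 1))
    have ha1 : 0 < a + 1 := by linarith
    rw [show 2 * (-b / (a + 1)) * b + (-b / (a + 1)) ^ 2 * a = -(b ^ 2 * (a + 2) / (a + 1) ^ 2)
      by field_simp; ring] at h
    have : 0 < b ^ 2 * (a + 2) / (a + 1) ^ 2 := by positivity
    linarith
  funext j
  have h1 := hb (Pi.single j 1)
  rw [dotProduct_mulVec_comm hQ, single_dotProduct, one_mul] at h1
  simpa using h1

/-- Translating by a kernel vector of a symmetric matrix does not change the quadratic form. -/
theorem quad_add_smul_ker {n : Type*} [Fintype n] {Q : Matrix n n ℝ} (hQ : Q.transpose = Q)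
    {x : n → ℝ} (hx : Q *ᵥ x = 0) (y : n → ℝ) (t : ℝ) :
    (y + t • x) ⬝ᵥ (Q *ᵥ (y + t • x)) = y ⬝ᵥ (Q *ᵥ y) := by
  have h1 : ∀ u, u ⬝ᵥ (Q *ᵥ x) = 0 := fun u => by rw [hx, dotProduct_zero]
  have h2 : ∀ u, x ⬝ᵥ (Q *ᵥ u) = 0 := fun u => by rw [dotProduct_mulVec_comm hQ, h1]
  simp [Matrix.mulVec_add, Matrix.mulVec_smul, dotProduct_add, add_dotProduct, dotProduct_smul,
    smul_dotProduct, h1, h2]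

/-- Determinant of the anisotropic dilation `y ↦ c y − ((c − 1) y i₀ / x i₀) x` of `ℝ³`
(it fixes the `x`-component and scales the complementary hyperplane `{y i₀ = 0}` by `c`). -/
theorem det_dilation (x : Fin 3 → ℝ) (i₀ : Fin 3) (hx : x i₀ ≠ 0) (c : ℝ) :
    LinearMap.det (c • LinearMap.id - ((c - 1) / x i₀) • (LinearMap.proj i₀).smulRight x :
      (Fin 3 → ℝ) →ₗ[ℝ] (Fin 3 → ℝ)) = c ^ 2 := by
  rw [← LinearMap.det_toMatrix']
  fin_cases i₀ <;>
  · simp only [Fin.zero_eta, Fin.mk_one, Fin.isValue, Fin.reduceFinMk] at hx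
    simp [Matrix.det_fin_three, LinearMap.toMatrix'_apply]
    field_simp
    ring

/-- **Degenerate directions destroy local integrability.** If `q : ℝ³ → ℝ` is continuous,
homogeneous of degree two, invariant under translation by a non-zero vector `x₀`, and `1/q` is
locally Lebesgue integrable, then `q ≡ 0`. (The weighted measure `(1/q) dy` is invariant under the
anisotropic dilations fixing the axis `ℝ x₀`; the cylinders `{|y i₀| < 1, ‖π y‖ < r}` then all have
the same finite weight, which by continuity from above is the weight of the axis, i.e. `0`.) -/
theorem eq_zero_of_locallyIntegrable_inv {q : (Fin 3 → ℝ) → ℝ} (hq : Continuous q)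
    (hhom : ∀ (c : ℝ) (y : Fin 3 → ℝ), q (c • y) = c ^ 2 * q y) {x₀ : Fin 3 → ℝ} (hx₀ : x₀ ≠ 0)
    (hinv : ∀ (y : Fin 3 → ℝ) (t : ℝ), q (y + t • x₀) = q y)
    (hint : LocallyIntegrable (fun y => 1 / q y)) (y : Fin 3 → ℝ) : q y = 0 := by
  obtain ⟨i₀, hi₀⟩ : ∃ i, x₀ i ≠ 0 := Function.ne_iff.mp hx₀
  -- oblique projection onto the hyperplane `{y i₀ = 0}` along `x₀`
  set π : (Fin 3 → ℝ) → (Fin 3 → ℝ) := fun y => y - (y i₀ / x₀ i₀) • x₀ with hπ_def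
  have hπ_cont : Continuous π := by
    have : Continuous fun y : Fin 3 → ℝ => y i₀ / x₀ i₀ := (continuous_apply i₀).div_const _
    exact continuous_id.sub (this.smul continuous_const)
  have hqπ : ∀ y, q (π y) = q y := fun y => by
    have := hinv y (-(y i₀ / x₀ i₀)); rwa [neg_smul, ← sub_eq_add_neg] at this
  -- cylinders around the axis `ℝ x₀`
  set E : ℝ → Set (Fin 3 → ℝ) := fun r => {y | |y i₀| < 1 ∧ ‖π y‖ < r} with hE_def
  have hE_open : ∀ r, IsOpen (E r) := fun r =>
    (isOpen_lt (continuous_abs.comp (continuous_apply i₀)) continuous_const).inter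
      (isOpen_lt (continuous_norm.comp hπ_cont) continuous_const)
  have hE_meas : ∀ r, MeasurableSet (E r) := fun r => (hE_open r).measurableSet
  have hE_mono : ∀ r s, r ≤ s → E r ⊆ E s := fun r s hrs y hy => ⟨hy.1, hy.2.trans_le hrs⟩
  -- the anisotropic dilations
  set A : ℝ → (Fin 3 → ℝ) →ₗ[ℝ] (Fin 3 → ℝ) := fun c =>
    c • LinearMap.id - ((c - 1) / x₀ i₀) • (LinearMap.proj i₀).smulRight x₀ with hA_def
  have hA_apply : ∀ c y, A c y = c • y - ((c - 1) / x₀ i₀ * y i₀) • x₀ := by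
    intro c y
    simp [hA_def, mul_smul]
  have hA_i₀ : ∀ c y, A c y i₀ = y i₀ := by
    intro c y
    simp only [hA_apply, Pi.sub_apply, Pi.smul_apply, smul_eq_mul]
    field_simp
    ring
  have hπA : ∀ c y, π (A c y) = c • π y := by
    intro c y
    simp only [hπ_def, hA_i₀]
    rw [hA_apply, smul_sub, sub_sub, ← add_smul, smul_smul]
    congr 2
    field_simp
    ring
  have hqA : ∀ c y, q (A c y) = c ^ 2 * q y := by
    intro c y
    rw [hA_apply, sub_eq_add_neg, ← neg_smul, hinv, hhom]
  have hA_det : ∀ c, LinearMap.det (A c) = c ^ 2 := fun c => det_dilation x₀ i₀ hi₀ c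
  have hA_meas : ∀ c, Measurable (A c) := fun c =>
    (LinearMap.continuous_of_finiteDimensional _).measurable
  -- change of variables under `A c`
  have hcov : ∀ c, 0 < c → ∀ g : (Fin 3 → ℝ) → ℝ≥0∞, Measurable g →
      ∫⁻ y, g (A c y) = ENNReal.ofReal ((c ^ 2)⁻¹) * ∫⁻ y, g y := by
    intro c hc g hg
    have hdet : LinearMap.det (A c) ≠ 0 := by rw [hA_det]; positivity
    rw [← lintegral_map hg (hA_meas c), Measure.map_linearMap_addHaar_eq_smul_addHaar _ hdet,
      lintegral_smul_measure, hA_det, abs_of_pos (by positivity), smul_eq_mul]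
  -- preimages of cylinders
  have hA_pre : ∀ c, 0 < c → ∀ r, (A c) ⁻¹' (E r) = E (r / c) := by
    intro c hc r
    ext y
    simp only [mem_preimage, hE_def, mem_setOf_eq, hA_i₀, hπA, norm_smul, Real.norm_eq_abs,
      abs_of_pos hc]
    rw [lt_div_iff₀ hc, mul_comm]
  -- the weighted volumes of the cylinders
  set F : (Fin 3 → ℝ) → ℝ≥0∞ := fun y => ‖1 / q y‖ₑ with hF_def
  have hF_meas : Measurable F := (measurable_const.div hq.measurable).enorm
  set J : ℝ → ℝ≥0∞ := fun r => ∫⁻ y in E r, F y with hJ_def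
  have hFA : ∀ c, 0 < c → ∀ y, F (A c y) = ENNReal.ofReal ((c ^ 2)⁻¹) * F y := by
    intro c hc y
    simp only [hF_def, hqA, one_div, mul_inv, enorm_mul]
    rw [Real.enorm_eq_ofReal (by positivity)]
  have hJ_eq : ∀ c, 0 < c → J (1 / c) = J 1 := by
    intro c hc
    have hc2 : ENNReal.ofReal ((c ^ 2)⁻¹) ≠ 0 := by
      rw [Ne, ENNReal.ofReal_eq_zero, not_le]; positivity
    have key := hcov c hc ((E 1).indicator F) (hF_meas.indicator (hE_meas 1))
    have lhs : (fun y => (E 1).indicator F (A c y)) =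
        fun y => ENNReal.ofReal ((c ^ 2)⁻¹) * (E (1 / c)).indicator F y := by
      funext y
      rw [← Set.indicator_comp_right (A c), hA_pre c hc]
      have hcomp : F ∘ ⇑(A c) = fun y => ENNReal.ofReal ((c ^ 2)⁻¹) * F y := funext (hFA c hc)
      rw [hcomp, Set.indicator_mul_right]
    rw [lhs, lintegral_const_mul _ (hF_meas.indicator (hE_meas _)), lintegral_indicator (hE_meas _),
      lintegral_indicator (hE_meas _)] at key
    exact (ENNReal.mul_right_inj hc2 ENNReal.ofReal_ne_top).1 key
  -- finiteness of `J 1` from local integrability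
  have hJ_fin : J 1 < ∞ := by
    set R : ℝ := 1 + ‖x₀‖ / |x₀ i₀| with hR
    have hsub : E 1 ⊆ Metric.closedBall (0 : Fin 3 → ℝ) R := by
      intro y hy
      rw [mem_closedBall_zero_iff]
      have hy' : y = π y + (y i₀ / x₀ i₀) • x₀ := by simp [hπ_def]
      have h2 : ‖(y i₀ / x₀ i₀) • x₀‖ ≤ ‖x₀‖ / |x₀ i₀| := by
        rw [norm_smul, Real.norm_eq_abs, abs_div]
        have hxpos : 0 < |x₀ i₀| := abs_pos.2 hi₀
        calc |y i₀| / |x₀ i₀| * ‖x₀‖ ≤ 1 / |x₀ i₀| * ‖x₀‖ := by gcongr; exact hy.1.le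
          _ = ‖x₀‖ / |x₀ i₀| := by ring
      calc ‖y‖ = ‖π y + (y i₀ / x₀ i₀) • x₀‖ := by rw [← hy']
        _ ≤ ‖π y‖ + ‖(y i₀ / x₀ i₀) • x₀‖ := norm_add_le _ _
        _ ≤ 1 + ‖x₀‖ / |x₀ i₀| := add_le_add hy.2.le h2
    have hK := (hint.integrableOn_isCompact (isCompact_closedBall (0 : Fin 3 → ℝ) R)).hasFiniteIntegral
    exact lt_of_le_of_lt (lintegral_mono_set hsub) hK
  -- continuity from above: `J 1` is the weight of the axis, a null set
  have hJ_zero : J 1 = 0 := by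
    set ν : Measure (Fin 3 → ℝ) := volume.withDensity F with hν
    have hνE : ∀ r, ν (E r) = J r := fun r => withDensity_apply F (hE_meas r)
    set s : ℕ → Set (Fin 3 → ℝ) := fun n => E (1 / ((n : ℝ) + 1)) with hs_def
    have hs_anti : Antitone s := by
      intro a b hab
      apply hE_mono
      gcongr
    have hs_meas : ∀ n, NullMeasurableSet (s n) ν := fun n => (hE_meas _).nullMeasurableSet
    have hνs : ∀ n, ν (s n) = J 1 := by
      intro n
      show ν (E (1 / ((n : ℝ) + 1))) = J 1
      rw [hνE]
      exact hJ_eq ((n:ℝ) + 1) (by positivity)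
    have hfin : ∃ n, ν (s n) ≠ ∞ := ⟨0, by rw [hνs]; exact hJ_fin.ne⟩
    have hiInter := hs_anti.measure_iInter hs_meas hfin
    simp only [hνs, ciInf_const] at hiInter
    have hsub : (⋂ n, s n) ⊆ (Submodule.span ℝ {x₀} : Set (Fin 3 → ℝ)) := by
      intro y hy
      rw [mem_iInter] at hy
      have hπy : π y = 0 := by
        by_contra hne
        obtain ⟨n, hn⟩ := exists_nat_one_div_lt (norm_pos_iff.2 hne)
        exact absurd (hy n).2 (not_lt.2 hn.le)
      have hy_eq : y = (y i₀ / x₀ i₀) • x₀ := sub_eq_zero.1 hπy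
      rw [SetLike.mem_coe, hy_eq]
      exact Submodule.smul_mem _ _ (Submodule.mem_span_singleton_self x₀)
    have hspan : (Submodule.span ℝ {x₀} : Submodule ℝ (Fin 3 → ℝ)) ≠ ⊤ := by
      intro htop
      have h1 := finrank_span_singleton (K := ℝ) hx₀
      rw [htop, finrank_top, Module.finrank_fin_fun ℝ] at h1
      norm_num at h1
    have hnull : ν (⋂ n, s n) = 0 := by
      apply measure_mono_null hsub
      apply withDensity_absolutelyContinuous
      exact Measure.addHaar_submodule volume _ hspan
    rw [hnull] at hiInter
    exact hiInter.symm
  -- `q` vanishes a.e. on `E 1`, hence on `E 1` by continuity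
  have hae : ∀ᵐ y ∂(volume : Measure (Fin 3 → ℝ)), y ∈ E 1 → F y = 0 :=
    (setLIntegral_eq_zero_iff (hE_meas 1) hF_meas).1 hJ_zero
  have hF0 : ∀ y, F y = 0 ↔ q y = 0 := fun y => by simp [hF_def]
  have hE1_zero : ∀ y ∈ E 1, q y = 0 := by
    by_contra hcon
    push Not at hcon
    obtain ⟨y₀, hy₀, hqy₀⟩ := hcon
    have hU : IsOpen (E 1 ∩ {y | q y ≠ 0}) := (hE_open 1).inter (isOpen_ne_fun hq continuous_const)
    have hpos : 0 < volume (E 1 ∩ {y | q y ≠ 0}) := hU.measure_pos volume ⟨y₀, hy₀, hqy₀⟩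
    have hzero : volume (E 1 ∩ {y | q y ≠ 0}) = 0 := by
      rw [ae_iff] at hae
      refine measure_mono_null ?_ hae
      intro y hy
      simp only [mem_setOf_eq, Classical.not_imp, hF0]
      exact ⟨hy.1, hy.2⟩
    exact hpos.ne' hzero
  -- `E 1` is a neighbourhood of `0`; conclude by homogeneity
  have h0 : (0 : Fin 3 → ℝ) ∈ E 1 := by simp [hE_def, hπ_def]
  have htend : Tendsto (fun c : ℝ => c • y) (𝓝 0) (𝓝 0) := by
    have : Continuous fun c : ℝ => c • y := continuous_id.smul continuous_const
    simpa using this.tendsto 0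
  have hev : ∀ᶠ c : ℝ in 𝓝[>] 0, c • y ∈ E 1 ∧ 0 < c :=
    ((htend.eventually ((hE_open 1).mem_nhds h0)).filter_mono nhdsWithin_le_nhds).and
      (eventually_nhdsWithin_of_forall fun c hc => hc)
  obtain ⟨c, hcE, hc⟩ := hev.exists
  have := hE1_zero _ hcE
  rw [hhom] at this
  exact (mul_eq_zero.1 this).resolve_left (by positivity)


end Summit.CriticalPhenomena.Ising3DConformalLimit.Theorems.HomogeneousEntireRigidity
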